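import Summits.Ventures.PercRepro.C041ZoneReach

/-!
# The zone split of the O-cube states, definitions (p6, gen 26; C-041.md §11 (e), the PERCOLATION DICTIONARY)

Setting of `C041ZoneReach`.  The INDEXED ZONES of `O` are its terminal-adjacent zones meeting `K₀` (`IsIdxZone`,
`ZoneIdx`); a ZONE-STATE of `Z` is a colouring of the edges of `Z` (`ZoneState Z`); a configuration restricts to a
zone-state (`restrictZone`) and a zone-state extends to a configuration (`extZone`: the zone's edges as given, the bare
edges outside `Z` as in `O`, every other edge red).  The local predicates of §11 are the global predicates of
`C041ZoneAdm` / `C041ZoneReach` evaluated on the extension: `AdmZone` (the per-edge cube conditions on `Z`'s bare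
edges, no sub-zone attached to both terminals, the sub-zone of `c` unattached), `BlueAtK` (every terminal edge at
`K_Z` blue), `AnchorDeleted` (an anchor of `Z` deleted on side `a`), `NoRedTwoReach` (no red `b`-edge at `REACH_Z`),
`ValidZone` (a red terminal edge at `K_Z`); the ZONE SETS `𝓛_Z`, `𝓤_Z`, `𝓡_Z` of §11 are `Lset`, `Uset`, `Rset`
(side `a`).  Proved here: the extension of an admissible zone-state is blue-below `O` and admissible
(`blueSub_extZone`, `adm_extZone`), the restriction of a configuration extends to a configuration agreeing with it on
the zone (`extZone_restrictZone_agree`), and the disjointness `𝓛_Z ∩ 𝓤_Z = ∅ = 𝓡_Z ∩ 𝓤_Z` (`disjoint_Lset_Uset`,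
`disjoint_Rset_Uset`).  The transfer of the global predicates to the zone-states ((H1), (H2)) and the gluing are the
next modules.
-/

namespace PercRepro

namespace MultiGraph

open Finset

variable {V E : Type*} {G : MultiGraph V E}

section SplitDefs

variable [Fintype V] (G) (a b c : V) (O : Config E)

/-- An indexed zone: a zone of `O` meeting `K₀` and carrying a terminal edge. -/
def IsIdxZone (Z : Finset V) : Prop :=
  (∃ z, Z = G.zone a b O z) ∧ (∃ v ∈ Z, v ∈ G.BareReach a b c O) ∧
    ∃ v ∈ Z, ∃ e, G.Joins e v a ∨ G.Joins e v b

/-- The indexed zones, as a type. -/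
abbrev ZoneIdx := {Z : Finset V // G.IsIdxZone a b c O Z}

/-- A zone-state of `Z`: a colouring of the edges of `Z`. -/
abbrev ZoneState (Z : Finset V) := {e : E // G.ZoneEdge a b Z e} → Bool

/-- The restriction of a configuration to the edges of `Z`. -/
def restrictZone (Z : Finset V) (S : Config E) : G.ZoneState a b Z := fun e => S e.1

open Classical in
/-- The extension of a zone-state to a configuration: the edges of `Z` as given, the bare edges outside `Z` as in `O`,
every other edge red. -/
noncomputable def extZone (Z : Finset V) (x : G.ZoneState a b Z) : Config E := fun e =>
  if h : G.ZoneEdge a b Z e then x ⟨e, h⟩ else if G.Bare a b e then O e else true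

variable {G a b c O}

omit [Fintype V] in
/-- The extension on an edge of the zone. -/
theorem extZone_of_zoneEdge {Z : Finset V} (x : G.ZoneState a b Z) {e : E} (h : G.ZoneEdge a b Z e) :
    G.extZone a b O Z x e = x ⟨e, h⟩ := by
  unfold extZone
  rw [dif_pos h]

omit [Fintype V] in
/-- The extension on a bare edge outside the zone. -/
theorem extZone_of_bare {Z : Finset V} (x : G.ZoneState a b Z) {e : E} (h : ¬ G.ZoneEdge a b Z e)
    (he : G.Bare a b e) : G.extZone a b O Z x e = O e := by
  unfold extZone
  rw [dif_neg h, if_pos he]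

omit [Fintype V] in
/-- The extension on a non-bare edge outside the zone. -/
theorem extZone_of_not_bare {Z : Finset V} (x : G.ZoneState a b Z) {e : E} (h : ¬ G.ZoneEdge a b Z e)
    (he : ¬ G.Bare a b e) : G.extZone a b O Z x e = true := by
  unfold extZone
  rw [dif_neg h, if_neg he]

omit [Fintype V] in
/-- The extension of the restriction agrees with the configuration on the edges of the zone. -/
theorem extZone_restrictZone_agree (Z : Finset V) (S : Config E) :
    ∀ e, G.ZoneEdge a b Z e → G.extZone a b O Z (G.restrictZone a b Z S) e = S e := by
  intro e he
  rw [extZone_of_zoneEdge _ he]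
  rfl

variable (G a b c O)

/-- An ADMISSIBLE zone-state: the per-edge cube conditions on the bare edges of `Z`, no sub-zone of `Z` attached to
both terminals, the sub-zone of `c` (when `c ∈ Z`) attached to neither. -/
def AdmZone (Z : Finset V) (x : G.ZoneState a b Z) : Prop :=
  (∀ e (h : G.ZoneEdge a b Z e), G.Bare a b e → O e = true → x ⟨e, h⟩ = true) ∧
    (∀ e (h : G.ZoneEdge a b Z e), G.Bare a b e → O e = false → x ⟨e, h⟩ = true → G.InteriorBlue a b O e) ∧
    (∀ v ∈ Z, ¬ (G.Attached a b (G.extZone a b O Z x) v a ∧ G.Attached a b (G.extZone a b O Z x) v b)) ∧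
    (c ∈ Z → ¬ G.Attached a b (G.extZone a b O Z x) c a ∧ ¬ G.Attached a b (G.extZone a b O Z x) c b)

/-- «Blue at `K`»: every terminal edge at a vertex of `K_Z` is blue. -/
def BlueAtK (Z : Finset V) (x : G.ZoneState a b Z) : Prop :=
  ∀ w, G.KZone a b c O (G.extZone a b O Z x) Z w →
    ∀ e, (G.Joins e w a ∨ G.Joins e w b) → G.extZone a b O Z x e = false

/-- An anchor of `Z` is deleted on side `a`: its sub-zone is attached to `a`. -/
def AnchorDeleted (Z : Finset V) (x : G.ZoneState a b Z) : Prop :=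
  ∃ w ∈ Z, w ∈ G.BareReach a b c O ∧ G.Attached a b (G.extZone a b O Z x) w a

/-- No red `b`-edge at a vertex of `REACH_Z` (side `a`). -/
def NoRedTwoReach (Z : Finset V) (x : G.ZoneState a b Z) : Prop :=
  ∀ w, G.ReachZone a b c O (G.extZone a b O Z x) Z w → ∀ e, G.Joins e w b → G.extZone a b O Z x e = false

/-- A red terminal edge at a vertex of `K_Z`. -/
def ValidZone (Z : Finset V) (x : G.ZoneState a b Z) : Prop :=
  ∃ w, G.KZone a b c O (G.extZone a b O Z x) Z w ∧
    ∃ e, G.extZone a b O Z x e = true ∧ (G.Joins e w a ∨ G.Joins e w b)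

open Classical in
/-- `𝓛_Z` (side `a`): admissible, blue at `K`, some anchor deleted. -/
noncomputable def Lset [Fintype E] [DecidableEq E] (Z : Finset V) : Finset (G.ZoneState a b Z) :=
  univ.filter fun x => G.AdmZone a b c O Z x ∧ G.BlueAtK a b c O Z x ∧ G.AnchorDeleted a b c O Z x

open Classical in
/-- `𝓤_Z`: admissible, blue at `K`, no anchor deleted. -/
noncomputable def Uset [Fintype E] [DecidableEq E] (Z : Finset V) : Finset (G.ZoneState a b Z) :=
  univ.filter fun x => G.AdmZone a b c O Z x ∧ G.BlueAtK a b c O Z x ∧ ¬ G.AnchorDeleted a b c O Z x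

open Classical in
/-- `𝓡_Z` (side `a`): admissible, no anchor deleted, no red `b`-edge at `REACH_Z`, a red terminal edge at `K_Z`. -/
noncomputable def Rset [Fintype E] [DecidableEq E] (Z : Finset V) : Finset (G.ZoneState a b Z) :=
  univ.filter fun x => G.AdmZone a b c O Z x ∧ ¬ G.AnchorDeleted a b c O Z x ∧
    G.NoRedTwoReach a b c O Z x ∧ G.ValidZone a b c O Z x

variable {G a b c O}

omit [Fintype V] in
/-- `𝓛_Z ∩ 𝓤_Z = ∅`. -/
theorem disjoint_Lset_Uset [Fintype E] [DecidableEq E] (Z : Finset V) : Disjoint (G.Lset a b c O Z) (G.Uset a b c O Z) := by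
  classical
  rw [Finset.disjoint_left]
  intro x hx hx'
  unfold Lset at hx
  unfold Uset at hx'
  rw [Finset.mem_filter] at hx hx'
  exact hx'.2.2.2 hx.2.2.2

omit [Fintype V] in
/-- `𝓡_Z ∩ 𝓤_Z = ∅`: a red terminal edge at `K_Z` against «blue at `K`». -/
theorem disjoint_Rset_Uset [Fintype E] [DecidableEq E] (Z : Finset V) : Disjoint (G.Rset a b c O Z) (G.Uset a b c O Z) := by
  classical
  rw [Finset.disjoint_left]
  intro x hx hx'
  unfold Rset at hx
  unfold Uset at hx'
  rw [Finset.mem_filter] at hx hx'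
  obtain ⟨w, hw, e, hSe, hj⟩ := hx.2.2.2.2
  rw [hx'.2.2.1 w hw e hj] at hSe
  exact absurd hSe (by decide)

omit [Fintype V] in
/-- The extension of an admissible zone-state is blue-below `O`. -/
theorem blueSub_extZone {Z : Finset V} {x : G.ZoneState a b Z} (hx : G.AdmZone a b c O Z x) :
    G.BlueSub a b O (G.extZone a b O Z x) := by
  intro e he hSe
  by_cases hZ : G.ZoneEdge a b Z e
  · rw [extZone_of_zoneEdge x hZ] at hSe
    by_contra hO
    have hO' : O e = true := by
      cases h : O e
      · exact absurd h hO
      · rfl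
    rw [hx.1 e hZ he hO'] at hSe
    exact absurd hSe (by decide)
  · rw [extZone_of_bare x hZ he] at hSe
    exact hSe

/-- Every vertex of a zone of a non-terminal is a non-terminal. -/
theorem ne_terminal_of_mem_zone {z v : V} (hz : z ≠ a ∧ z ≠ b) (hv : v ∈ G.zone a b O z) : v ≠ a ∧ v ≠ b :=
  ne_terminal_of_blueBareConn ((mem_zone a b O).1 hv) hz

/-- A vertex of an indexed zone is a non-terminal. -/
theorem ne_terminal_of_mem_idxZone (hc : c ≠ a ∧ c ≠ b) {Z : Finset V} (hZ : G.IsIdxZone a b c O Z) {v : V}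
    (hv : v ∈ Z) : v ≠ a ∧ v ≠ b := by
  obtain ⟨⟨z, rfl⟩, ⟨w, hw, hwK⟩, _⟩ := hZ
  have hw' : w ≠ a ∧ w ≠ b := by
    induction hwK with
    | refl => exact hc
    | tail _ hbc _ =>
      obtain ⟨e, he, _, hj⟩ := hbc
      exact (ne_of_bare_joins he hj).2
  rw [mem_zone] at hv hw
  exact ne_terminal_of_blueBareConn (hw.symm.trans hv) hw'

omit [Fintype V] in
/-- The non-terminal end of a terminal edge is determined. -/
theorem eq_of_joins_terminal {e : E} {w t u : V} (hj : G.Joins e w t) (hu : u ≠ a ∧ u ≠ b) (ht : t = a ∨ t = b)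
    (hue : G.EdgeAt e u) : u = w := by
  have hut : u ≠ t := by
    rcases ht with rfl | rfl
    · exact hu.1
    · exact hu.2
  rcases hue with h | h <;> rcases hj with ⟨h1, h2⟩ | ⟨h1, h2⟩
  · exact h.symm.trans h1
  · exact absurd (h.symm.trans h1) hut
  · exact absurd (h.symm.trans h2) hut
  · exact h.symm.trans h2

/-- An edge between the terminals is not an edge of an indexed zone. -/
theorem not_zoneEdge_of_joins_terminals (hc : c ≠ a ∧ c ≠ b) {Z : Finset V} (hZ : G.IsIdxZone a b c O Z) {e : E}
    (he : G.Joins e a b) : ¬ G.ZoneEdge a b Z e := by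
  rintro (⟨hb, _, _⟩ | ⟨u, hu, hj⟩)
  · exact hb.1 (EdgeAt.of_joins_left he)
  · have hu' := ne_terminal_of_mem_idxZone hc hZ hu
    rcases hj with hj | hj
    · exact hu'.2 (eq_of_joins_terminal he.symm hu' (Or.inl rfl) (EdgeAt.of_joins_left hj))
    · exact hu'.1 (eq_of_joins_terminal he hu' (Or.inr rfl) (EdgeAt.of_joins_left hj))

/-- Outside an indexed zone, the extension of an admissible zone-state has no attachment at all: a blue bare walk from a
vertex outside `Z` stays outside `Z`, where every terminal edge is red. -/
theorem not_attached_extZone_of_notMem (hc : c ≠ a ∧ c ≠ b) {Z : Finset V} (hZ : G.IsIdxZone a b c O Z)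
    {x : G.ZoneState a b Z} (hx : G.AdmZone a b c O Z x) {v : V} (hv : v ∉ Z) {t : V} (ht : t = a ∨ t = b) :
    ¬ G.Attached a b (G.extZone a b O Z x) v t := by
  rintro ⟨w, hvw, e, hSe, hj⟩
  obtain ⟨z, hZz⟩ := hZ.1
  have hsub := blueSub_extZone hx
  have hw : w ∉ Z := fun hw => hv (hZz ▸ mem_zone_of_blueBareConn hsub (hZz ▸ hw) hvw.symm)
  have hZe : ¬ G.ZoneEdge a b Z e := by
    rintro (⟨he, _, _⟩ | ⟨u, hu, hj'⟩)
    · rcases ht with rfl | rfl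
      · exact he.1 (EdgeAt.of_joins_right hj)
      · exact he.2 (EdgeAt.of_joins_right hj)
    · have hu' := ne_terminal_of_mem_idxZone hc hZ hu
      have hue : G.EdgeAt e u := by
        rcases hj' with hj' | hj' <;> exact EdgeAt.of_joins_left hj'
      exact hw ((eq_of_joins_terminal hj hu' ht hue) ▸ hu)
  have : G.extZone a b O Z x e = true := by
    apply extZone_of_not_bare x hZe
    rintro ⟨h1, h2⟩
    rcases ht with rfl | rfl
    · exact h1 (EdgeAt.of_joins_right hj)
    · exact h2 (EdgeAt.of_joins_right hj)
  rw [this] at hSe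
  exact absurd hSe (by decide)

/-- **The extension of an admissible zone-state of an indexed zone is admissible** (`c`, `a`, `b` pairwise
blue-disconnected), by (F2). -/
theorem adm_extZone (hc : c ≠ a ∧ c ≠ b) (hne : a ≠ b) {Z : Finset V} (hZ : G.IsIdxZone a b c O Z)
    {x : G.ZoneState a b Z} (hx : G.AdmZone a b c O Z x) :
    ¬ G.Conn (G.extZone a b O Z x)ᶜ c a ∧ ¬ G.Conn (G.extZone a b O Z x)ᶜ c b ∧
      ¬ G.Conn (G.extZone a b O Z x)ᶜ a b := by
  rw [adm_iff a b c hc hne]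
  refine ⟨fun e he => ?_, fun v hva hvb hv => ?_, ?_⟩
  · apply extZone_of_not_bare x (not_zoneEdge_of_joins_terminals hc hZ he)
    rintro ⟨h1, _⟩
    exact h1 (EdgeAt.of_joins_left he)
  · by_cases hvZ : v ∈ Z
    · exact hx.2.2.1 v hvZ hv
    · exact not_attached_extZone_of_notMem hc hZ hx hvZ (Or.inl rfl) hv.1
  · by_cases hcZ : c ∈ Z
    · exact hx.2.2.2 hcZ
    · exact ⟨not_attached_extZone_of_notMem hc hZ hx hcZ (Or.inl rfl),
        not_attached_extZone_of_notMem hc hZ hx hcZ (Or.inr rfl)⟩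

end SplitDefs

end MultiGraph

end PercRepro
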